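/-
Copyright: lit-balaban cell, Phase-2 proof seat p33 (gen 9).  Statement-level skeleton of a published paper; no proof claims beyond
what the kernel checks below.
-/
import Literature.MathematicalPhysics.QuantumFieldTheory.BalabanImbrieJaffe1984to88.BIJ85LocalSmoothGauge326
import Literature.MathematicalPhysics.QuantumFieldTheory.Balaban1983to89.B4Thm110RegionLp

/-!
# `BalabanImbrieJaffe1984to88.BIJ85SmoothGaugeRegular17` — T. Bałaban, J. Imbrie, A. Jaffe, *Renormalization of the Higgs model:
minimizers, propagators and the stability of mean field theory*, Commun. Math. Phys. **97** (1985) 299–329 [BalabanImbrieJaffe1985],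
Sect. 7.3 p. 326 [PDF 28] with [7] = T. Bałaban, *Regularity and decay of lattice Green's functions*, Commun. Math. Phys. **89** (1983)
571–597 [Balaban1983RegularityDecay], (1.7)–(1.8) pp. 572–573 [PDF 2–3]: **THE LOCAL SMOOTH GAUGE OF THE ACTUAL BACKGROUND IS REGULAR
IN THE SENSE OF [7] (1.7), AND [7]'s (1.8) AND (1.10) APPLY TO IT** — file 3 after `BIJ85SmoothPotential326` / `BIJ85LocalSmoothGauge326`.

statement-level skeleton of published theorems with citation tags; proofs where landed; nothing here is a claim about the Yang–Mills mass gap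

PDFs held: `paper:balaban1985-cmp97-bij-higgs-minimizers` (journal page = PDF page + 298), p. 326 [PDF 28]; `paper:balaban1983-cmp89-regularity-decay`
(journal page = PDF page + 570), pp. 572–573 [PDF 2–3]; both read this session (text layer).

CITATION HEADER (lean-in-tree rule).  Phase-2 file of the lit-balaban TYPED SKELETON (HOME `run/shared/lean/pub/lit-balaban/`), seat p33
gen 9 (unit `lit-balaban-p33-g9`; TAKING line HOME/STATUS.md 2026-08-22T00:17Z); SKELETON rows **C1.Eq7.3.1-7.3.2** (owner r15, referee
ref-5) × **B4.Claim@573(1.8)** / **B4.Thm@573** (1.10) and their standing hypothesis (1.7) (owner r01).  THE PRINTED TEXTS, verbatim.  p. 326: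
*"The propagators arising from Δ_k(u_k), under the restriction (7.3.1) on the gauge field, also satisfy the regularity and decay estimates
of [7]. In order to remain within the framework of this reference, we remark that by change of gauge u_k can be transformed in a local
region Λ into a configuration of the form exp[ie_kηA], where A is smooth and small."*  [7] p. 572–573: *"We consider all these operators
under the assumption that the vector field A is regular on Ω in the sense that |(∂^η_μA)(x)| ≤ ce^{β−1}, x ∈ Ω, μ = 1, …, d, β > 0, (1.7)
and c is some universal constant. … there exists a positive constant γ₀ such that for e sufficiently small and for a regular vector field A
−Δ^{η,N}_{A,Ω} + aP_k(A) ≥ γ₀I. (1.8) The constant γ₀ is independent of the lattice spacing η, as well as of Ω and of A."*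

WHAT IS PROVED (0 `sorry`, standard axioms; theorems only, no definition, no named fact).
* §1 `tendsto_logWeight_mul_rpow` (`(1 + log e⁻¹)^p·e^s → 0` as `e → 0⁺`, `s > 0`), **`exists_threshold_regular17`**: for every `K`, `p`,
  `β < 1`, `c > 0` there is `e₁ > 0` with `e𝓅(e) ≤ ½` and `K𝓅(e) ≤ c·e^{β−1}` for `0 < e ≤ e₁` (`𝓅(e) = (1 + log e⁻¹)^p`, the (7.3.1) weight); `eta_le_one`, `eta_eq_inv_pow`, `blk_bounds` (plumbing).
* §2 **`exists_regular17_gauge_allTori` — «A IS SMOOTH AND SMALL» IN THE PRINTED FORM (1.7) OF [7]**: for every `d ≥ 2`, `L`, `p`, box size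
  `n`, `β < 1` and `c > 0` there is `e₁ > 0` such that on every torus (`P.d = d`, `P.L = L`), every scale `1 ≤ k ≤ m + K`, every
  `0 < e ≤ e₁`, every unit field `v` with (7.3.1) `|v(∂p) − 1| ≤ e𝓅(e)`, and every box `[lo, lo + n]` of the η-torus (`n < sitesPerDir 0`):
  `u_k(b) = exp(ie((∂λ)(b) + ηA(b)))` on the box bonds with `|A(b)| ≤ c·e^{β−1}` there and `|A(⟨z + e_μ, ν⟩) − A(⟨z, ν⟩)| ≤ c·e^{β−1}·η`,
  i.e. `|(∂^η_μA)(z)| ≤ ce^{β−1}`, whenever `z, z + e_μ ∈ [lo, lo + n]` (file 2's `K(1 + d(nη + 1))²𝓅(e)` absorbed by §1).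
* §3 **`regular17_fineDom_of_box` / `regular_b4_of_box`** — THE BRIDGE TO r01's TYPED CARRIER of [7]: for a torus of dimension
  `P.d = d + 1` and a finite set `Ω` of unit labels of [7]'s lattice `ℤ^{d+1}` (lattice units, `L^k` fine points per unit length) whose blocks
  sit with one bond of slack in the box, the component field `A_ν(x) := A(⟨x, ν⟩)` (transported along `Fin (d+1) = Fin P.d`) satisfies the
  hypothesis `hreg` of r01's [7]-theorems, `|A_ν(x + e_μ) − A_ν(x)| ≤ c·e^{β−1}/L^k` on the fine region — equivalently r01's
  `(B4Lower18RegularRegion.regularRegionSetting F a c β ⟨L^k, Ω, e, A_·⟩).regular` — (1.7) verbatim in lattice units.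
* §4 **`claim18_local_smooth_gauge_allTori` — (1.8) OF [7] FOR THE ACTUAL BACKGROUND'S LOCAL SMOOTH GAUGE**: for the rotation flow
  (`N = 2`, the abelian Higgs representation), every `a > 0`, `0 < β < 1`, `c > 0`: there are `γ₀ > 0` and `e₁ > 0` (independent of the
  torus, the scale, `Ω` and `A`) such that under (7.3.1) with `0 < e ≤ e₁` the operator `−Δ^{η,N}_{A,Ω} + aP_k(A)` of [7] (1.6) built on
  `U = e^{qeηA}` for THIS `A` is `≥ γ₀` on `L²(Ω)` — r01's hypothesis-free family theorem `claim18Printed_regularRegion_rot` COMPOSED with §3.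
* §5 **`thm110_value_local_smooth_gauge_allTori` — THE VALUE DECAY (1.10) OF [7]'s THEOREM p. 573 FOR `G_k(Ω, A)` AT THIS `A`**: r01's
  hypothesis-free `B4Thm110RegionLp.thm110_value_region_unitBlock` (unions `Ω` of `K₀`-blocks, `8 ∣ K₀`; `δ₀ = 1/K₀`; `R₀ = K₀(d + 3)` unit
  labels; `f` supported in one unit block) COMPOSED with §3: `|(G_k(Ω, A)f)(x)_i| ≤ c₀·e^{−D/(L^kK₀)}·‖f‖_∞` for `0 < e ≤ e₁(c, β, …)` under (7.3.1),
  on every torus with `P.L = ℓ + 1` and every scale.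
HONEST SCOPE.  (i) [7]'s operator is r01's typed `b4Op` on the region `Ω ⊂ ℤ^{d+1}` with Neumann bonds and staircase contours, fed with the
potential `A` of the gauge-transformed `u_k` on the box; the identification of [BIJ85]'s torus operator `Δ_k(u_k)` restricted to `Λ` with
[7]'s `−Δ^{η,N}_{A,Ω} + aP_k(A)` (gauge covariance under `λ`, torus-to-region restriction, the mass/`δ`-terms of (3.1.1)) is NOT made here,
nor are [7]'s Hölder/δG members (1.9), (1.11)–(1.12) invoked — HOME/GAPS.md G-C1-05 (a).  (ii) Boxes that do not wrap (`n < sitesPerDir 0`), as in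
files 1–2; `e₁` depends on `(d, L, p, n, β, c)` and in §4 also on `a` — "for e sufficiently small".  (iii) `β < 1` is needed to absorb the
logarithm (for `β ≥ 1` the printed (1.7) would force `∂A → 0` faster than (7.3.1) gives).  Unit `lit-balaban-p33`
(literature-prover-lit-balaban-p33-g9-0), 2026-08-22.  NOT summit progress.
-/

open scoped BigOperators

namespace Literature.MathematicalPhysics.QuantumFieldTheory.BalabanImbrieJaffe1984to88.BIJ85SmoothGaugeRegular17

open Balaban1983to89 hiding Site Plaq
open Balaban1983to89.LatticeFieldCalculus
open Balaban1983to89.T4AxialGaugeSmallField (castSite boxBonds)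
open Balaban1983to89.B7Prop1Explicit (e e_apply)
open BIJ85Sect1Model (U1Field plaq)
open BIJ85Eq454PlaqResidual (actualBg eta_mul_L_pow)
open BIJ85Sigma422Eta (eta_pos eta_inv)
open BIJ85LocalSmoothGauge326 (exists_local_smooth_gauge_of_hyp731)
open Balaban1983to89.B4 (Claim18Printed)
open Balaban1983to89.B4GaugeCovariance (OrthFlow)
open Balaban1983to89.B4Lower18 (fineDom mem_fineDom)
open Balaban1983to89.B4Lower18Regular (e1)
open Balaban1983to89.B4Lower18RegularRegion (RegularRegionInstance regularRegionSetting claim18Printed_regularRegion_rot)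
open Balaban1983to89.B4Lower18 (IsBlockUnion)
open Balaban1983to89.B4Lower18Regular (rot_lipschitz)
open Balaban1983to89.B4Lemma21Region (regionOp)
open Balaban1983to89.B4WalkRouteRegion (rpos)
open Balaban1983to89.B4Thm110RegionLp (thm110_value_region_unitBlock)
open Filter Topology
open scoped Matrix
-- inside this namespace the bare `Site`/`Plaq` are the `ℤ^d` carriers of the QFT root; the torus ones are renamed:
open Balaban1983to89 renaming Site → TSite, Plaq → TPlaq

noncomputable section

variable {P : Params}

/-! ## §1  The logarithmic weight of (7.3.1) against a power: `K𝓅(e) ≤ c·e^{β−1}` for `e` small -/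

/-- `(1 + log e⁻¹)^p · e^s → 0` as `e → 0⁺`, for every real `p` and every `s > 0`. [folklore] -/
private theorem tendsto_logWeight_mul_rpow (p : ℝ) {s : ℝ} (hs : 0 < s) :
    Tendsto (fun x : ℝ => (1 + Real.log x⁻¹) ^ p * x ^ s) (𝓝[>] 0) (𝓝 0) := by
  have h1 : Tendsto (fun y : ℝ => y ^ p * Real.exp (-s * y)) atTop (𝓝 0) :=
    tendsto_rpow_mul_exp_neg_mul_atTop_nhds_zero p s hs
  have h2 : Tendsto (fun x : ℝ => 1 + Real.log x⁻¹) (𝓝[>] 0) atTop := by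
    refine tendsto_atTop_add_const_left _ _ ?_
    have h := tendsto_neg_atBot_atTop.comp Real.tendsto_log_nhdsGT_zero
    refine h.congr' ?_
    filter_upwards [self_mem_nhdsWithin] with x _
    simp [Real.log_inv]
  have h3 : Tendsto (fun x : ℝ => Real.exp s * ((1 + Real.log x⁻¹) ^ p * Real.exp (-s * (1 + Real.log x⁻¹)))) (𝓝[>] 0)
      (𝓝 0) := by
    simpa using (h1.comp h2).const_mul (Real.exp s)
  refine h3.congr' ?_
  filter_upwards [self_mem_nhdsWithin] with x (hx : 0 < x)
  rw [Real.rpow_def_of_pos hx, Real.log_inv, show -s * (1 + -Real.log x) = -s + Real.log x * s by ring, Real.exp_add,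
    Real.exp_neg]
  field_simp

/-- **THRESHOLD**: for every `K`, `p`, `β < 1`, `c > 0` there is `0 < e₁ < 1` such that for `0 < e ≤ e₁`: the weight `(1 + log e⁻¹)^p` is
nonnegative, `e·(1 + log e⁻¹)^p ≤ ½` (the side condition of files 1–2) and `K·(1 + log e⁻¹)^p ≤ c·e^{β−1}` — "for e sufficiently small".
[cite: Balaban1983RegularityDecay, (1.7)–(1.8) p.573] -/
theorem exists_threshold_regular17 (K p : ℝ) {β c : ℝ} (hβ : β < 1) (hc : 0 < c) :
    ∃ e₁ : ℝ, 0 < e₁ ∧ e₁ < 1 ∧ ∀ x : ℝ, 0 < x → x ≤ e₁ →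
      0 ≤ (1 + Real.log x⁻¹) ^ p ∧ x * (1 + Real.log x⁻¹) ^ p ≤ 1 / 2 ∧ K * (1 + Real.log x⁻¹) ^ p ≤ c * x ^ (β - 1) := by
  have hA := (tendsto_logWeight_mul_rpow p one_pos).eventually (gt_mem_nhds (show (0 : ℝ) < 1 / 2 by norm_num))
  have hq : 0 < c / (|K| + 1) := div_pos hc (by positivity)
  have hB := (tendsto_logWeight_mul_rpow p (sub_pos.mpr hβ)).eventually (gt_mem_nhds hq)
  obtain ⟨δ, hδ, h⟩ := (nhdsGT_basis (0 : ℝ)).eventually_iff.mp (hA.and hB)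
  refine ⟨min (δ / 2) (1 / 2), lt_min (half_pos hδ) one_half_pos, (min_le_right _ _).trans_lt one_half_lt_one, fun x hx hxle => ?_⟩
  have hxδ : x < δ := (hxle.trans (min_le_left _ _)).trans_lt (half_lt_self hδ)
  have hx1 : x ≤ 1 := (hxle.trans (min_le_right _ _)).trans one_half_lt_one.le
  obtain ⟨h1, h2⟩ := h ⟨hx, hxδ⟩
  have hw : 0 ≤ (1 + Real.log x⁻¹) ^ p := by
    refine Real.rpow_nonneg ?_ _
    have : 0 ≤ Real.log x⁻¹ := Real.log_nonneg (one_le_inv_iff₀.mpr ⟨hx, hx1⟩)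
    linarith
  refine ⟨hw, ?_, ?_⟩
  · rw [Real.rpow_one] at h1
    rw [mul_comm]
    exact h1.le
  · have hsplit : x ^ (1 - β) * x ^ (β - 1) = 1 := by
      rw [← Real.rpow_add hx, show 1 - β + (β - 1) = 0 by ring, Real.rpow_zero]
    have hpow : 0 ≤ x ^ (β - 1) := Real.rpow_nonneg hx.le _
    calc K * (1 + Real.log x⁻¹) ^ p ≤ |K| * (1 + Real.log x⁻¹) ^ p := by gcongr; exact le_abs_self K
      _ = |K| * ((1 + Real.log x⁻¹) ^ p * x ^ (1 - β)) * x ^ (β - 1) := by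
          rw [mul_assoc, mul_assoc, hsplit, mul_one]
      _ ≤ |K| * (c / (|K| + 1)) * x ^ (β - 1) := by gcongr
      _ ≤ c * x ^ (β - 1) := by
          gcongr
          rw [mul_div_assoc', div_le_iff₀ (by positivity)]
          nlinarith [abs_nonneg K]

/-! ## §2  «A is smooth and small» in the printed form (1.7) of [7] -/

/-- `η ≤ 1`. [cite: BalabanImbrieJaffe1985, (2.1) p.302] -/
theorem eta_le_one (P : Params) (k : ℕ) : P.eta k ≤ 1 := by
  rw [Params.eta]
  exact pow_le_one₀ (inv_nonneg.mpr (Nat.cast_nonneg _)) (inv_le_one_of_one_le₀ (by exact_mod_cast P.L_pos))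

/-- `η = (L^k)⁻¹`. [cite: BalabanImbrieJaffe1985, (2.1) p.302] -/
theorem eta_eq_inv_pow (P : Params) (k : ℕ) : P.eta k = ((P.L : ℝ) ^ k)⁻¹ := by
  rw [← eta_inv, inv_inv]

/-- **«A IS SMOOTH AND SMALL» — (1.7) OF [7] FOR THE LOCAL SMOOTH GAUGE OF THE ACTUAL BACKGROUND, ALL TORI AND SCALES**: for every `d ≥ 2`,
`L`, `p`, box size `n`, `β < 1`, `c > 0` there is `e₁ > 0` such that on every torus (`P.d = d`, `P.L = L`), every scale `1 ≤ k ≤ m + K`, every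
`0 < e ≤ e₁`, every unit field `v` with (7.3.1) `|v(∂p) − 1| ≤ e(1 + log e⁻¹)^p`, and every box `[lo, lo + n]` of the η-torus with
`n < sitesPerDir 0`: `u_k(b) = exp(ie((∂λ)(b) + ηA(b)))` on the box bonds, `|A(b)| ≤ c·e^{β−1}` there, and
`|A(⟨z + e_μ, ν⟩) − A(⟨z, ν⟩)| ≤ c·e^{β−1}·η` — i.e. `|(∂^η_μA)(z)| ≤ ce^{β−1}`, (1.7) — whenever `z, z + e_μ ∈ [lo, lo + n]`.
[cite: BalabanImbrieJaffe1985, Sect. 7.3 p.326 closing paragraph; Balaban1983RegularityDecay, (1.7) p.572] -/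
theorem exists_regular17_gauge_allTori {d L : ℕ} (hd : 2 ≤ d) (hL : Odd L ∧ 1 < L) (pexp : ℝ) (n : ℕ) {β c : ℝ} (hβ : β < 1)
    (hc : 0 < c) :
    ∃ e₁ : ℝ, 0 < e₁ ∧ ∀ (P : Params) (hPd : P.d = d), P.L = L → ∀ (k : ℕ), 1 ≤ k → ∀ (hk : k ≤ P.m + P.K)
      (e₀ : ℝ), 0 < e₀ → e₀ ≤ e₁ →
      ∀ (v : U1Field P k), (∀ p : TPlaq P k, ‖((plaq v p : Circle) : ℂ) - 1‖ ≤ e₀ * (1 + Real.log e₀⁻¹) ^ pexp) →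
      ∀ (lo hi : Fin P.d → ℤ), (∀ κ, hi κ ≤ lo κ + n) → n < P.sitesPerDir 0 →
      ∃ (lam : TSite P 0 → ℝ) (A : PBond P 0 → ℝ),
        (∀ b ∈ boxBonds lo hi, actualBg (hd.trans_eq hPd.symm) k e₀ v b = Circle.exp (e₀ * (grad 1 lam b + P.eta k * A b))) ∧
        (∀ b ∈ boxBonds lo hi, |A b| ≤ c * e₀ ^ (β - 1)) ∧
        (∀ (z : Fin P.d → ℤ) (μ ν : Fin P.d), lo ≤ z → z + e μ ≤ hi →
          |A ⟨castSite (z + e μ), ν⟩ - A ⟨castSite z, ν⟩| ≤ c * e₀ ^ (β - 1) * P.eta k) := by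
  obtain ⟨K, hK, hall⟩ := exists_local_smooth_gauge_of_hyp731 hd hL pexp
  obtain ⟨e₁, he₁, -, hthr⟩ := exists_threshold_regular17 (K * (1 + (d : ℝ) * ((n : ℝ) + 1)) ^ 2) pexp hβ hc
  refine ⟨e₁, he₁, fun P hPd hPL k hk1 hk e₀ he hle v hv lo hi hn hnN => ?_⟩
  obtain ⟨hw, hside, hKc⟩ := hthr e₀ he hle
  obtain ⟨lam, A, hform, hsup, hgrad⟩ := hall P hPd hPL k hk1 hk e₀ he hside v hv lo hi n hn hnN
  have hη0 : 0 < P.eta k := eta_pos P k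
  have hη1 : P.eta k ≤ 1 := eta_le_one P k
  -- the box factor of file 2 is at most its `η = 1` value, which §1 absorbed into `e₁`
  have hfac : K * (1 + (d : ℝ) * ((n : ℝ) * P.eta k + 1)) ^ 2 * (1 + Real.log e₀⁻¹) ^ pexp ≤ c * e₀ ^ (β - 1) := by
    have hn1 : (n : ℝ) * P.eta k ≤ n := mul_le_of_le_one_right (Nat.cast_nonneg n) hη1
    have hb : (1 + (d : ℝ) * ((n : ℝ) * P.eta k + 1)) ^ 2 ≤ (1 + (d : ℝ) * ((n : ℝ) + 1)) ^ 2 := by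
      gcongr
    have h3 : K * (1 + (d : ℝ) * ((n : ℝ) * P.eta k + 1)) ^ 2 * (1 + Real.log e₀⁻¹) ^ pexp ≤
        K * (1 + (d : ℝ) * ((n : ℝ) + 1)) ^ 2 * (1 + Real.log e₀⁻¹) ^ pexp := by
      gcongr
    exact h3.trans hKc
  refine ⟨lam, A, hform, fun b hb => (hsup b hb).trans hfac, fun z μ ν hz hz' => ?_⟩
  have hsplit : A ⟨castSite (z + e μ), ν⟩ - A ⟨castSite z, ν⟩ =
      P.eta k * ((P.L : ℝ) ^ k * (A ⟨castSite (z + e μ), ν⟩ - A ⟨castSite z, ν⟩)) := by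
    rw [← mul_assoc, eta_mul_L_pow, one_mul]
  rw [hsplit, abs_mul, abs_of_pos hη0]
  calc P.eta k * |(P.L : ℝ) ^ k * (A ⟨castSite (z + e μ), ν⟩ - A ⟨castSite z, ν⟩)|
      ≤ P.eta k * (c * e₀ ^ (β - 1)) := by gcongr; exact (hgrad z μ ν hz hz').trans hfac
    _ = c * e₀ ^ (β - 1) * P.eta k := by ring

/-! ## §3  The bridge to [7]'s typed carrier (r01's regular-region family and region operator)

[7] works on `Ω ⊂ ηℤ^{d+1}` in lattice units: fine points `x : Fin (d+1) → ℤ`, `n = L^k` of them per unit length, a vector field in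
component form `A_ν(x)`, and «regular» := (1.7) verbatim, `|A_ν(x + e_μ) − A_ν(x)| ≤ c·e^{β−1}/n` for `x ∈ Ω` (r01's
`B4Lower18RegularRegion.regularRegionSetting … |>.regular`, and the hypothesis `hreg` of r01's `B4Thm110RegionLp.thm110_value_region`).  A torus of
[BIJ85] with `P.d = d + 1` indexes its η-sites by `Fin P.d → ℤ` (`castSite`); we transport along `Fin.cast` and feed `A_ν(x) := A(⟨x, ν⟩)`. -/

/-- transport of [7]'s unit vector: `(x + e_μ) ∘ cast = x ∘ cast + e_{cast μ}`. [folklore] -/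
private theorem comp_cast_add_e1 {d : ℕ} (hPd : P.d = d + 1) (x : Fin (d + 1) → ℤ) (μ : Fin (d + 1)) :
    (fun j : Fin P.d => (x + e1 μ) (Fin.cast hPd j)) = (fun j : Fin P.d => x (Fin.cast hPd j)) + e (Fin.cast hPd.symm μ) := by
  funext j
  simp only [Pi.add_apply, e1, e, Pi.single_apply]
  congr 1
  simp [Fin.ext_iff]

/-- a fine point of the block `B(y)` (lattice units, `b` points per unit length): `b·y_i ≤ x_i < b·y_i + b`. [cite: Balaban1983RegularityDecay, (1.1) p.572] -/
theorem blk_bounds {d b : ℕ} (hb : 1 ≤ b) (x : Fin (d + 1) → ℤ) (i : Fin (d + 1)) :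
    (b : ℤ) * Balaban1983to89.B4Reflection242.blk b x i ≤ x i ∧ x i < (b : ℤ) * Balaban1983to89.B4Reflection242.blk b x i + b := by
  have hb0 : (0 : ℤ) < b := by exact_mod_cast hb
  simp only [Balaban1983to89.B4Reflection242.blk]
  exact ⟨Int.mul_ediv_self_le hb0.ne', Int.lt_mul_ediv_self_add hb0⟩

/-- **THE BRIDGE — (1.7) IN [7]'s LATTICE UNITS ON A UNION OF UNIT BLOCKS**: if `|A(⟨z + e_μ, ν⟩) − A(⟨z, ν⟩)| ≤ c·e^{β−1}·η` whenever
`z, z + e_μ ∈ [lo, hi]` (§2), then for every finite set `Ω` of unit labels whose blocks sit in the box with one bond of slack (`lo ≤ L^k·y`,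
`L^k·y + L^k ≤ hi` coordinatewise) the component field `A_ν(x) := A(⟨x, ν⟩)` satisfies `|A_ν(x + e_μ) − A_ν(x)| ≤ c·e^{β−1}/L^k` for all fine
`x ∈ Ω` — (1.7) verbatim in lattice units, the hypothesis `hreg` of r01's [7]-theorems. [cite: Balaban1983RegularityDecay, (1.7) p.572] -/
theorem regular17_fineDom_of_box {d : ℕ} (hPd : P.d = d + 1) {k : ℕ} {e₀ β c : ℝ} {A : PBond P 0 → ℝ} {lo hi : Fin P.d → ℤ}
    (hgradA : ∀ (z : Fin P.d → ℤ) (μ ν : Fin P.d), lo ≤ z → z + e μ ≤ hi →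
      |A ⟨castSite (z + e μ), ν⟩ - A ⟨castSite z, ν⟩| ≤ c * e₀ ^ (β - 1) * P.eta k)
    (Ωc : Finset (Fin (d + 1) → ℤ))
    (hΩ : ∀ y ∈ Ωc, ∀ i : Fin (d + 1),
      lo (Fin.cast hPd.symm i) ≤ (P.L : ℤ) ^ k * y i ∧ (P.L : ℤ) ^ k * y i + (P.L : ℤ) ^ k ≤ hi (Fin.cast hPd.symm i)) :
    ∀ x ∈ fineDom (P.L ^ k) Ωc, ∀ μ ν : Fin (d + 1),
      |A ⟨castSite (fun j : Fin P.d => (x + e1 μ) (Fin.cast hPd j)), Fin.cast hPd.symm ν⟩ -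
          A ⟨castSite (fun j : Fin P.d => x (Fin.cast hPd j)), Fin.cast hPd.symm ν⟩| ≤
        c * e₀ ^ (β - 1) / ((P.L ^ k : ℕ) : ℝ) := by
  have hLk : 1 ≤ P.L ^ k := Nat.one_le_pow _ _ P.L_pos
  have hcast : ((P.L ^ k : ℕ) : ℤ) = (P.L : ℤ) ^ k := by push_cast; rfl
  intro x hx μ ν
  have hy := (mem_fineDom hLk).mp hx
  set z : Fin P.d → ℤ := fun j => x (Fin.cast hPd j) with hz_def
  have hjj : ∀ j : Fin P.d, Fin.cast hPd.symm (Fin.cast hPd j) = j := fun j => Fin.ext (by simp)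
  have hz : lo ≤ z := by
    intro j
    have h1 := (hΩ _ hy (Fin.cast hPd j)).1
    rw [hjj] at h1
    have h2 := (blk_bounds hLk x (Fin.cast hPd j)).1
    rw [hcast] at h2
    exact h1.trans h2
  have hz' : z + e (Fin.cast hPd.symm μ) ≤ hi := by
    intro j
    have h1 := (hΩ _ hy (Fin.cast hPd j)).2
    rw [hjj] at h1
    have h2 := (blk_bounds hLk x (Fin.cast hPd j)).2
    rw [hcast] at h2
    have h3 : e (Fin.cast hPd.symm μ) j ≤ (1 : ℤ) := by
      rw [e_apply]
      split_ifs <;> norm_num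
    simp only [Pi.add_apply, hz_def]
    linarith
  have hmain := hgradA z (Fin.cast hPd.symm μ) (Fin.cast hPd.symm ν) hz hz'
  have hη : c * e₀ ^ (β - 1) * P.eta k = c * e₀ ^ (β - 1) / ((P.L ^ k : ℕ) : ℝ) := by
    rw [eta_eq_inv_pow, div_eq_mul_inv]
    push_cast
    rfl
  rw [← hη]
  simpa only [comp_cast_add_e1 hPd x μ, hz_def] using hmain

/-- the same as membership of r01's regular-region FAMILY: the instance `⟨L^k, Ω, e, A_·⟩` of `B4Lower18RegularRegion.regularRegionSetting F a c β`
is `regular`, for every flow `F` and every `a`. [cite: Balaban1983RegularityDecay, (1.7) p.572] -/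
theorem regular_b4_of_box {d : ℕ} (hPd : P.d = d + 1) {k : ℕ} {e₀ β c : ℝ} {A : PBond P 0 → ℝ} {lo hi : Fin P.d → ℤ}
    (hgradA : ∀ (z : Fin P.d → ℤ) (μ ν : Fin P.d), lo ≤ z → z + e μ ≤ hi →
      |A ⟨castSite (z + e μ), ν⟩ - A ⟨castSite z, ν⟩| ≤ c * e₀ ^ (β - 1) * P.eta k)
    (Ωc : Finset (Fin (d + 1) → ℤ))
    (hΩ : ∀ y ∈ Ωc, ∀ i : Fin (d + 1),
      lo (Fin.cast hPd.symm i) ≤ (P.L : ℤ) ^ k * y i ∧ (P.L : ℤ) ^ k * y i + (P.L : ℤ) ^ k ≤ hi (Fin.cast hPd.symm i))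
    {ι : Type} [Fintype ι] [DecidableEq ι] (F : OrthFlow ι) (a : ℝ) :
    (regularRegionSetting F a c β
      ⟨P.L ^ k, Nat.one_le_pow _ _ P.L_pos, Ωc, e₀,
        fun x ν => A ⟨castSite (fun j : Fin P.d => x (Fin.cast hPd j)), Fin.cast hPd.symm ν⟩⟩).regular :=
  regular17_fineDom_of_box hPd hgradA Ωc hΩ

/-! ## §4  (1.8) of [7] for the actual background's local smooth gauge -/

/-- **(1.8) OF [7] HOLDS FOR THE LOCAL SMOOTH GAUGE OF THE ACTUAL BACKGROUND (4.5.4) UNDER (7.3.1), ALL TORI AND SCALES** — for the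
rotation flow (`N = 2`: the complex scalar field of the abelian Higgs model as `ℝ²`), every `a > 0`, `0 < β < 1`, `c > 0`, `p` and box size `n`:
there are `γ₀ > 0` and `e₁ > 0` such that on every torus of dimension `P.d = d + 1` (`P.L = L`), every scale `1 ≤ k ≤ m + K`, every
`0 < e ≤ e₁`, every unit field `v` with (7.3.1) `|v(∂p) − 1| ≤ e(1 + log e⁻¹)^p`, every box `[lo, lo + n]` (`n < sitesPerDir 0`) and every
finite set `Ω` of unit labels whose blocks sit in the box with one bond of slack: `u_k = exp[ie(∂λ + ηA)]` on the box bonds, `A` is regular on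
`Ω` in the sense of (1.7), AND `−Δ^{η,N}_{A,Ω} + aP_k(A) ≥ γ₀I` — r01's `lower18 γ₀` of the instance `⟨L^k, Ω, e, A_·⟩` (the operator (1.6) of
[7] at `m² = 0` built on `U = e^{qeηA}` for this `A`, Neumann bonds of `Ω`, staircase contours).  *"The constant γ₀ is independent of the lattice
spacing η, as well as of Ω and of A."*  Composition of §§2–3 with r01's `claim18Printed_regularRegion_rot`; see HONEST SCOPE (i) for what is
NOT identified. [cite: BalabanImbrieJaffe1985, Sect. 7.3 p.326; Balaban1983RegularityDecay, (1.8) p.573] -/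
theorem claim18_local_smooth_gauge_allTori {d L : ℕ} (hd : 1 ≤ d) (hL : Odd L ∧ 1 < L) (pexp : ℝ) (n : ℕ) {a β c : ℝ}
    (ha : 0 < a) (hβ0 : 0 < β) (hβ1 : β < 1) (hc : 0 < c) :
    ∃ γ₀ e₁ : ℝ, 0 < γ₀ ∧ 0 < e₁ ∧ ∀ (P : Params) (hPd : P.d = d + 1), P.L = L → ∀ (k : ℕ), 1 ≤ k → ∀ (hk : k ≤ P.m + P.K)
      (e₀ : ℝ), 0 < e₀ → e₀ ≤ e₁ →
      ∀ (v : U1Field P k), (∀ p : TPlaq P k, ‖((plaq v p : Circle) : ℂ) - 1‖ ≤ e₀ * (1 + Real.log e₀⁻¹) ^ pexp) →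
      ∀ (lo hi : Fin P.d → ℤ), (∀ κ, hi κ ≤ lo κ + n) → n < P.sitesPerDir 0 →
      ∀ (Ωc : Finset (Fin (d + 1) → ℤ)), (∀ y ∈ Ωc, ∀ i : Fin (d + 1),
        lo (Fin.cast hPd.symm i) ≤ (P.L : ℤ) ^ k * y i ∧ (P.L : ℤ) ^ k * y i + (P.L : ℤ) ^ k ≤ hi (Fin.cast hPd.symm i)) →
      ∃ (lam : TSite P 0 → ℝ) (A : PBond P 0 → ℝ),
        (∀ b ∈ boxBonds lo hi, actualBg ((Nat.succ_le_succ hd).trans_eq hPd.symm) k e₀ v b =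
          Circle.exp (e₀ * (grad 1 lam b + P.eta k * A b))) ∧
        (regularRegionSetting OrthFlow.rot a c β
          ⟨P.L ^ k, Nat.one_le_pow _ _ P.L_pos, Ωc, e₀,
            fun x ν => A ⟨castSite (fun j : Fin P.d => x (Fin.cast hPd j)), Fin.cast hPd.symm ν⟩⟩).regular ∧
        (regularRegionSetting OrthFlow.rot a c β
          ⟨P.L ^ k, Nat.one_le_pow _ _ P.L_pos, Ωc, e₀,
            fun x ν => A ⟨castSite (fun j : Fin P.d => x (Fin.cast hPd j)), Fin.cast hPd.symm ν⟩⟩).lower18 γ₀ := by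
  obtain ⟨γ₀, e₁', hγ₀, he₁', hfam⟩ := claim18Printed_regularRegion_rot (d := d) ha hc.le hβ0
  obtain ⟨e₁, he₁, hall⟩ := exists_regular17_gauge_allTori (Nat.succ_le_succ hd) hL pexp n hβ1 hc
  refine ⟨γ₀, min e₁ e₁', hγ₀, lt_min he₁ he₁', fun P hPd hPL k hk1 hk e₀ he hle v hv lo hi hn hnN Ωc hΩ => ?_⟩
  obtain ⟨lam, A, hform, -, hgradA⟩ := hall P hPd hPL k hk1 hk e₀ he (hle.trans (min_le_left _ _)) v hv lo hi hn hnN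
  have hreg := regular_b4_of_box hPd hgradA Ωc hΩ OrthFlow.rot a
  exact ⟨lam, A, hform, hreg, hfam _ hreg he (hle.trans (min_le_right _ _))⟩

/-! ## §5  (1.10) of [7] (value member) for the actual background's local smooth gauge -/

/-- **THE DECAY ESTIMATE (1.10) OF [7] FOR `G_k(Ω, A)` AT THE LOCAL SMOOTH GAUGE OF THE ACTUAL BACKGROUND (4.5.4) UNDER (7.3.1), ALL TORI
AND SCALES** — *"The propagators … also satisfy the regularity and decay estimates of [7]"*, the value member of [7]'s Theorem p. 573
«|(G_k(Ω,A)f)(x)| ≤ c₀ exp(−δ₀ dist(x, supp f))‖f‖_∞ (1.10) for x ∈ Ω, dist(x, Ωᶜ) ≥ R₀» in r01's hypothesis-free typed form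
`B4Thm110RegionLp.thm110_value_region_unitBlock` (rotation flow `N = 2`; `L = ℓ + 1`; windows `a ∈ [a₋, a₊]`, `0 ≤ m² ≤ m₊²`; cube size
`K₀`, `8 ∣ K₀`; `δ₀ = 1/K₀` per η-unit; `R₀ = K₀(d + 3)` unit labels; `f` supported in one unit block at `ℓ^∞`-distance `≥ D`), COMPOSED
with §§2–3: there are `K₀`, `c₀ > 0` and, for every `c > 0`, `0 < β < 1`, an `e₁ > 0` such that on every torus (`P.d = d + 1`, `P.L = ℓ + 1`),
every scale, every `0 < e ≤ e₁`, every unit field `v` with (7.3.1), every box `[lo, lo + n]` and every union `Ω` of `K₀`-blocks whose unit blocks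
sit in the box with one bond of slack, `u_k = exp[ie(∂λ + ηA)]` on the box bonds AND [7]'s Green's function
`G_k(Ω, A) = (−Δ^{η,N}_{A,Ω} + m² + a_kP_k(A))⁻¹` (r01's `regionOp`, built on `U = e^{qeηA}` for THIS `A`) obeys (1.10).  See HONEST SCOPE (i):
the identification of `G_k(Ω, A)` with [BIJ85]'s `G_k(u_k)` restricted to `Λ` is NOT made here.
[cite: BalabanImbrieJaffe1985, Sect. 7.3 p.326; Balaban1983RegularityDecay, Theorem (1.10) p.573] -/
theorem thm110_value_local_smooth_gauge_allTori {d ℓ : ℕ} (hd : 1 ≤ d) (hℓ : 1 ≤ ℓ) (hodd : Odd (ℓ + 1)) (pexp : ℝ) (n : ℕ)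
    (amin aplus m2plus : ℝ) (ha : 0 < amin) :
    ∃ K₀ : ℕ, 8 ≤ K₀ ∧ 8 ∣ K₀ ∧ ∃ c₀ : ℝ, 0 < c₀ ∧ ∀ (c β : ℝ), 0 < c → 0 < β → β < 1 →
      ∃ e₁ : ℝ, 0 < e₁ ∧ ∀ (P : Params) (hPd : P.d = d + 1), P.L = ℓ + 1 → ∀ (k : ℕ), 1 ≤ k → ∀ (hk : k ≤ P.m + P.K)
      (e₀ : ℝ), 0 < e₀ → e₀ ≤ e₁ →
      ∀ (v : U1Field P k), (∀ p : TPlaq P k, ‖((plaq v p : Circle) : ℂ) - 1‖ ≤ e₀ * (1 + Real.log e₀⁻¹) ^ pexp) →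
      ∀ (lo hi : Fin P.d → ℤ), (∀ κ, hi κ ≤ lo κ + n) → n < P.sitesPerDir 0 →
      ∀ (Ωc : Finset (Fin (d + 1) → ℤ)), IsBlockUnion K₀ Ωc → (∀ y ∈ Ωc, ∀ i : Fin (d + 1),
        lo (Fin.cast hPd.symm i) ≤ (P.L : ℤ) ^ k * y i ∧ (P.L : ℤ) ^ k * y i + (P.L : ℤ) ^ k ≤ hi (Fin.cast hPd.symm i)) →
      ∃ (lam : TSite P 0 → ℝ) (A : PBond P 0 → ℝ),
        (∀ b ∈ boxBonds lo hi, actualBg ((Nat.succ_le_succ hd).trans_eq hPd.symm) k e₀ v b =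
          Circle.exp (e₀ * (grad 1 lam b + P.eta k * A b))) ∧
        ∀ (hn : 1 ≤ (ℓ + 1) ^ k) (a m2 : ℝ), amin ≤ a → a ≤ aplus → 0 ≤ m2 → m2 ≤ m2plus →
        ∀ (x : ↥(fineDom ((ℓ + 1) ^ k) Ωc)),
          (∀ y : Fin (d + 1) → ℤ, (∀ μ, |y μ - Balaban1983to89.B4Reflection242.blk ((ℓ + 1) ^ k) x.1 μ| ≤ (K₀ : ℤ) * (d + 3)) →
            y ∈ Ωc) →
        ∀ (y₀ : Fin (d + 1) → ℤ) (D : ℝ),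
          (∀ x' : ↥(fineDom ((ℓ + 1) ^ k) Ωc), Balaban1983to89.B4Reflection242.blk ((ℓ + 1) ^ k) x'.1 = y₀ →
            ∃ μ, D ≤ |rpos ((ℓ + 1) ^ k) Ωc x μ - rpos ((ℓ + 1) ^ k) Ωc x' μ|) →
        ∀ (f : ↥(fineDom ((ℓ + 1) ^ k) Ωc) × Fin 2 → ℝ),
          (∀ p, Balaban1983to89.B4Reflection242.blk ((ℓ + 1) ^ k) p.1.1 ≠ y₀ → f p = 0) →
        ∀ i : Fin 2,
          |((regionOp OrthFlow.rot e₀ hn (B1.aSeq a ((ℓ : ℝ) + 1) k) m2 Ωc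
              (fun x ν => A ⟨castSite (fun j : Fin P.d => x (Fin.cast hPd j)), Fin.cast hPd.symm ν⟩))⁻¹ *ᵥ f) (x, i)|
            ≤ c₀ * Real.exp (-(D / ((((ℓ + 1) ^ k : ℕ) : ℝ) * K₀))) * ‖f‖ := by
  obtain ⟨K₀, hK8, h8, c₀, hc₀, H⟩ :=
    thm110_value_region_unitBlock OrthFlow.rot zero_le_one rot_lipschitz d ℓ hℓ amin aplus m2plus ha
  refine ⟨K₀, hK8, h8, c₀, hc₀, fun c β hc hβ0 hβ1 => ?_⟩
  obtain ⟨e₁', he₁', H'⟩ := H c β hc.le hβ0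
  have hL : Odd (ℓ + 1) ∧ 1 < ℓ + 1 := ⟨hodd, by omega⟩
  obtain ⟨e₁, he₁, hall⟩ := exists_regular17_gauge_allTori (Nat.succ_le_succ hd) hL pexp n hβ1 hc
  refine ⟨min e₁ e₁', lt_min he₁ he₁', fun P hPd hPL k hk1 hk e₀ he hle v hv lo hi hn hnN Ωc hBU hΩ => ?_⟩
  obtain ⟨lam, A, hform, -, hgradA⟩ := hall P hPd hPL k hk1 hk e₀ he (hle.trans (min_le_left _ _)) v hv lo hi hn hnN
  refine ⟨lam, A, hform, fun hn' a m2 ha1 ha2 hm1 hm2 x hR y₀ D hD f hf i => ?_⟩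
  have hreg := regular17_fineDom_of_box hPd hgradA Ωc hΩ
  rw [hPL] at hreg
  exact H' k hk1 hn' a m2 ha1 ha2 hm1 hm2 Ωc hBU
    (fun x ν => A ⟨castSite (fun j : Fin P.d => x (Fin.cast hPd j)), Fin.cast hPd.symm ν⟩) e₀ he
    (hle.trans (min_le_right _ _)) hreg x hR y₀ D hD f hf i

end

end Literature.MathematicalPhysics.QuantumFieldTheory.BalabanImbrieJaffe1984to88.BIJ85SmoothGaugeRegular17
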